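import Literature.IUT.HodgeTheaters.PiAvatarLocalLabels
import Literature.IUT.HodgeTheaters.PiAvatarLocalOvergroup
import Literature.IUT.HodgeTheaters.InitialThetaDataOvergroupStable
import HarnessLib

/-!
# KIT-INSTANCE-SPEC P5-binding, LOCAL slots (II): the type-`(1,l-tors)` TWIN `†𝒟_v̲^± = ℬ(Π_{X̲_K} ∩ augGF⁻¹ G_v̲)⁰` of the
# overgroup object at a good place — [IUTchI] Def 6.1 (ii) with the UNDERLINE (RULINGS #55 (1) / ref-g G29-F2; defs — post-freeze
# additive D13, not a cone member)

S. Mochizuki, *Inter-universal Teichmüller theory I*, kurims manuscript (May 2020), Def 6.1 (ii) p. 156 l.2–22: «if `v ∈ V^non`, then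
`π₁(†𝒟_v)` determines, in a functorial fashion, a topological [in fact, profinite if `v ∈ V^good`] group corresponding to “`X̲_v`” [cf.
Corollary 1.2 if `v ∈ V^good`; [EtTh], Proposition 2.4, if `v ∈ V^bad`], which contains `π₁(†𝒟_v)` as an open subgroup; thus, if we write
`†𝒟_v^±` for `ℬ(−)⁰` of this topological group, then we obtain a natural morphism `†𝒟_v → †𝒟_v^±`» — the curve is **`X̲_v` UNDERLINED**,
of type `(1,l-tors)` (HOME/lit/IUTchI-DEF61-VERBATIM.md, certified 2026-08-26; Def 6.1 (iii) l.30–35: the `±`-label classes are indexed by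
the order-`l` quotient `Q` of [EtTh] Def 2.1) ([IUTchI] Def 6.1 (ii) p.156) [claim: Mochizuki2012, status: disputed] (D-0012 claim key,
series status DISPUTED — definitions and kernel theorems over abc-iut-L5-t2's REAL `InitialThetaData`; the automorphism-extension square
is conditional on the interface law `LocalArrowLaw` of `PiAvatarLocalLabels`; nothing of the series is asserted, no side is taken on
[IUTchIII] Cor. 3.12).

## Why (abc-iut-L5-lead RULINGS #55 (1), binding rule of the D13 kit lane)
abc-iut-L5-t4 gen 3's `pmObjModel Gv = ℬ(Π_{X_K} ∩ augGF⁻¹ G_v̲)⁰` (p432369, FROZEN) is a TRUE overgroup object of `𝒟_v̲ = ℬ(Π_v̲)⁰`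
(`Π_v̲ = Π_{X̲→_K} ∩ augGF⁻¹ G_v̲`), but it is the type-`(1,1)` (`X_v`-level, index `l²`) member of the Cor 1.2 tower, whereas Def 6.1 (ii)'s
`†𝒟_v^±` is the type-`(1,l-tors)` member `ℬ(Π_{X̲_K} ∩ augGF⁻¹ G_v̲)⁰` (index `l`; its cusps ARE the `l` `±`-label classes of Def 6.1 (iii)).
This file types the TWIN under new names and leaves p432369 untouched; only the twin is ever bound into the `pmObj` slot.
* `pmUndObjModel Gv := ℬ(Π_{X̲_K} ∩ augGF⁻¹ G_v̲)⁰`, `toPMUndModel : 𝒟_v̲ ⟶ †𝒟_v̲^±` (`xΠ_v̲ ↦ xΠ^±_v̲`), `pmUndToPMModel : ℬ(Π^±_v̲)⁰ ⟶ ℬ(Π_{X_v})⁰`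
  with the TOWER `toPMUndModel ≫ pmUndToPMModel = toPMModel` (`X̲→_v̲ → X̲_v̲ → X_v̲`); containments `PiXarrow_inf_le_PiXund_inf`,
  `PiXund_inf_le_PiXK_inf`; `map_augGF_PiXund_inf` / `map_augGF_PiXarrow_inf` (`= G_K ∩ G_v̲`) — UNCONDITIONAL;
* `conj_smul_PiXK_inf_eq_of_mem_normalizer_PiXund_inf`, `normalizer_PiXund_inf_le_normalizer_PiXK_inf` — the normaliser step
  `X̲_v ⇒ X_v` (t1's argument: `Π_{X_K} = Π_{X_F} ∩ augGF⁻¹ G_K`, `Π_{X_F} ⊴ Π_{C_F}`) — UNCONDITIONAL;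
* UNDER `Λ : D.LocalArrowLaw CG hS Π_v̲` (every automorphism of `𝒟_v̲` is induced by one of `𝒟^{⊚±}`): `conj_smul_PiXund_inf_eq`,
  **`normalizer_loc_le_normalizer_pmUnd`** (`N(Π_v̲) ≤ N(Π^±_v̲)`, Cor 1.2 embedded at the `X̲`-level — NOT derivable from the typed §1/§3
  data alone: `Π_{X̲_K}` has no description `N ∩ augGF⁻¹ G_K` with `N ⊴ Π_{C_F}`, its geometric part being moved by `G_F` outside the Borel),
  **`autPMUndOfAut`** and the square **`toPMUndModel_autPMUndOfAut`** (functoriality of `†𝒟_v ↦ †𝒟_v^±`), `autPMUndOfAut_eq_of_eq`.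
No instance, no notation; typed ≠ proved elsewhere; binder ≠ fact.
-/

noncomputable section

namespace Literature.IUT.HodgeTheaters

open CategoryTheory
open scoped Pointwise

universe u v w

/-! ### Plumbing (private) -/

section Plumbing

variable {P Q : Type*} [Group P] [Group Q]

/-- `(S ⊓ f⁻¹ T).map f = f(S) ⊓ T`. [folklore] -/
private theorem und_map_inf_comap_eq (f : P →* Q) (S : Subgroup P) (T : Subgroup Q) :
    (S ⊓ T.comap f).map f = S.map f ⊓ T := by
  refine le_antisymm (le_inf (Subgroup.map_mono inf_le_left) (Subgroup.map_le_iff_le_comap.mpr inf_le_right)) ?_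
  rintro y ⟨⟨s, hs, rfl⟩, hy⟩
  exact ⟨s, ⟨hs, hy⟩, rfl⟩

/-- `a • f⁻¹ T = f⁻¹ (f a • T)`. [folklore] -/
private theorem und_conj_smul_comap_eq (f : P →* Q) (T : Subgroup Q) (a : P) :
    MulAut.conj a • T.comap f = (MulAut.conj (f a) • T).comap f := by
  ext x
  rw [Subgroup.mem_pointwise_smul_iff_inv_smul_mem, Subgroup.mem_comap, Subgroup.mem_comap,
    Subgroup.mem_pointwise_smul_iff_inv_smul_mem, MulAut.smul_def, MulAut.conj_inv_apply, MulAut.smul_def,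
    MulAut.conj_inv_apply, map_mul, map_mul, map_inv]

/-- If `a` normalises `S` and `f(S) = T` then `f a • T ≤ T`. [folklore] -/
private theorem und_conj_smul_le_of_map_eq (f : P →* Q) {S : Subgroup P} {T : Subgroup Q} (hS : S.map f = T)
    {b : P} (hb : b ∈ Subgroup.normalizer (S : Set P)) : MulAut.conj (f b) • T ≤ T := by
  intro x hx
  rw [Subgroup.mem_pointwise_smul_iff_inv_smul_mem, ← hS] at hx
  obtain ⟨s, hs, hsx⟩ := hx
  rw [← hS]
  refine ⟨b * s * b⁻¹, (Subgroup.mem_normalizer_iff.mp hb s).mp hs, ?_⟩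
  rw [map_mul, map_mul, map_inv, hsx, MulAut.smul_def, MulAut.conj_inv_apply]
  group

/-- If `a` normalises `S` and `f(S) = T` then `f a • T = T`. [folklore] -/
private theorem und_conj_smul_eq_of_map_eq (f : P →* Q) {S : Subgroup P} {T : Subgroup Q} (hS : S.map f = T)
    {a : P} (ha : a ∈ Subgroup.normalizer (S : Set P)) : MulAut.conj (f a) • T = T := by
  refine le_antisymm (und_conj_smul_le_of_map_eq f hS ha) fun x hx => ?_
  have h' := und_conj_smul_le_of_map_eq f hS ((Subgroup.normalizer (S : Set P)).inv_mem ha)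
  have hx' : (MulAut.conj (f a))⁻¹ • x ∈ T := by
    refine h' ?_
    rw [map_inv, map_inv]
    exact Subgroup.smul_mem_pointwise_smul _ _ _ hx
  exact Subgroup.mem_pointwise_smul_iff_inv_smul_mem.mpr hx'

/-- `a • T = T ⇒ a ∈ N(T)`. [folklore] -/
private theorem und_mem_normalizer_of_conj_smul_eq {T : Subgroup P} {a : P} (h : MulAut.conj a • T = T) :
    a ∈ Subgroup.normalizer (T : Set P) := by
  rw [Subgroup.mem_set_normalizer_iff]
  intro x
  rw [SetLike.mem_coe, SetLike.mem_coe, ← MulAut.conj_apply, ← MulAut.smul_def,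
    ← Subgroup.mem_inv_pointwise_smul_iff, ← h, inv_smul_smul, h]

end Plumbing

section LocalOvergroupUnd

variable {F : Type u} {K : Type v} {Fbar : Type w} [Field F] [NumberField F] [Field K] [NumberField K]
  [Algebra F K] [Field Fbar] [Algebra F Fbar] [Algebra K Fbar]
  {E : WeierstrassCurve F} [E.IsElliptic] {l : ℕ} {Pb : BadPlacePredicates K}
  (D : InitialThetaData F K Fbar E l Pb) (Gv : Subgroup (Fbar ≃ₐ[F] Fbar))

namespace InitialThetaData

/-! ### The type-(1,l-tors) overgroup object and the tower `X̲→_v̲ → X̲_v̲ → X_v̲` -/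

/-- **Kit slot `pmObj` at the model local object of a good `v̲` (Def 6.1 (ii) with the underline): `†𝒟_v̲^± := ℬ(Π_{X̲_K} ∩ augGF⁻¹ G_v̲)⁰`**,
the "`X̲_v̲`"-type (type `(1,l-tors)`) overgroup object of `𝒟_v̲ = ℬ(Π_{X̲→_K} ∩ augGF⁻¹ G_v̲)⁰`. ([IUTchI] Def 6.1 (ii) p.156) [claim: Mochizuki2012, status: disputed] -/
abbrev pmUndObjModel : D.PiAmbient := OrbitCat.of (D.PiXund ⊓ Gv.comap D.augGF)

/-- `Π_v̲ ≤ Π^±_v̲`: `Π_{X̲→_K} ∩ augGF⁻¹ G_v̲ ≤ Π_{X̲_K} ∩ augGF⁻¹ G_v̲`. ([IUTchI] Def 6.1 (ii) p.156) [claim: Mochizuki2012, status: disputed] -/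
theorem PiXarrow_inf_le_PiXund_inf : D.PiXarrow ⊓ Gv.comap D.augGF ≤ D.PiXund ⊓ Gv.comap D.augGF :=
  inf_le_inf_right _ D.PiXarrow_le_PiXund

/-- `Π^±_v̲ ≤ Π_{X_K} ∩ augGF⁻¹ G_v̲` (the type-`(1,1)` member of the tower, p432369's `pmObjModel`).
([IUTchI] Def 6.1 (ii) p.156) [claim: Mochizuki2012, status: disputed] -/
theorem PiXund_inf_le_PiXK_inf : D.PiXund ⊓ Gv.comap D.augGF ≤ D.PiXK ⊓ Gv.comap D.augGF :=
  inf_le_inf_right _ D.PiXund_le_PiXK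

/-- **Kit slot `toPM` at the model: the natural morphism `†𝒟_v̲ → †𝒟_v̲^±`** (`xΠ_v̲ ↦ xΠ^±_v̲`).
([IUTchI] Def 6.1 (ii) p.156) [claim: Mochizuki2012, status: disputed] -/
def toPMUndModel : D.locModelObj Gv ⟶ D.pmUndObjModel Gv :=
  OrbitCat.homOfElem 1 (OrbitCat.one_conj_mem_of_le (D.PiXarrow_inf_le_PiXund_inf Gv))

/-- `toPMUnd` on cosets: `xΠ_v̲ ↦ xΠ^±_v̲`. ([IUTchI] Def 6.1 (ii) p.156) [claim: Mochizuki2012, status: disputed] -/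
theorem fn_toPMUndModel (x : D.PiC) :
    OrbitCat.fn (D.toPMUndModel Gv) (QuotientGroup.mk x : D.PiC ⧸ (D.PiXarrow ⊓ Gv.comap D.augGF)) =
      (QuotientGroup.mk (x * 1) : D.PiC ⧸ (D.PiXund ⊓ Gv.comap D.augGF)) :=
  OrbitCat.fn_homOfElem (H := D.PiXarrow ⊓ Gv.comap D.augGF) (K := D.PiXund ⊓ Gv.comap D.augGF) 1 _ x

/-- The second storey of the tower: `ℬ(Π^±_v̲)⁰ → ℬ(Π_{X_K} ∩ augGF⁻¹ G_v̲)⁰` (`X̲_v̲ → X_v̲`).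
([IUTchI] Def 6.1 (ii) p.156) [claim: Mochizuki2012, status: disputed] -/
def pmUndToPMModel : D.pmUndObjModel Gv ⟶ D.pmObjModel Gv :=
  OrbitCat.homOfElem 1 (OrbitCat.one_conj_mem_of_le (D.PiXund_inf_le_PiXK_inf Gv))

/-- **The tower `X̲→_v̲ → X̲_v̲ → X_v̲`**: `toPMUnd ≫ (X̲_v̲ → X_v̲) = toPM` (p432369's morphism to the type-`(1,1)` object).
([IUTchI] Def 6.1 (ii) p.156) [claim: Mochizuki2012, status: disputed] -/
theorem toPMUndModel_comp_pmUndToPMModel : D.toPMUndModel Gv ≫ D.pmUndToPMModel Gv = D.toPMModel Gv := by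
  apply OrbitCat.hom_ext_fn
  funext q
  induction q using Quotient.inductionOn' with
  | h x =>
    change (QuotientGroup.mk (x * 1 * 1) : D.PiC ⧸ (D.PiXK ⊓ Gv.comap D.augGF)) = QuotientGroup.mk (x * 1)
    rw [mul_one]

/-! ### Images under `augGF` and the normaliser step `X̲_v̲ ⇒ X_v̲` (unconditional) -/

/-- `augGF(Π^±_v̲) = G_K ∩ G_v̲`. ([IUTchI] Def 3.1 (e) p.62) [claim: Mochizuki2012, status: disputed] -/
theorem map_augGF_PiXund_inf : (D.PiXund ⊓ Gv.comap D.augGF).map D.augGF = galoisSubgroupOf F K Fbar ⊓ Gv := by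
  rw [und_map_inf_comap_eq, map_augGF_PiXund]

/-- `augGF(Π_v̲) = G_K ∩ G_v̲`. ([IUTchI] Def 3.1 (f) p.63) [claim: Mochizuki2012, status: disputed] -/
theorem map_augGF_PiXarrow_inf : (D.PiXarrow ⊓ Gv.comap D.augGF).map D.augGF = galoisSubgroupOf F K Fbar ⊓ Gv := by
  rw [und_map_inf_comap_eq, map_augGF_PiXarrow]

/-- `Π^±_v̲ = Π_{X̲_K} ∩ augGF⁻¹(G_K ∩ G_v̲)` (`Π_{X̲_K} ≤ augGF⁻¹ G_K`). ([IUTchI] Def 3.1 (e) p.62) [claim: Mochizuki2012, status: disputed] -/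
theorem PiXund_inf_eq_inf_comap_inf :
    D.PiXund ⊓ Gv.comap D.augGF = D.PiXund ⊓ (galoisSubgroupOf F K Fbar ⊓ Gv).comap D.augGF := by
  refine le_antisymm (le_inf inf_le_left fun x hx => ?_) (inf_le_inf_left _ (Subgroup.comap_mono inf_le_right))
  rw [Subgroup.mem_comap, Subgroup.mem_inf]
  refine ⟨?_, (Subgroup.mem_inf.mp hx).2⟩
  have h := D.PiXund_le_PiCK (Subgroup.mem_inf.mp hx).1
  rw [PiCK_eq_comap_augGF] at h
  exact h

/-- **The normaliser step `X̲_v̲ ⇒ X_v̲`**: an element normalising `Π^±_v̲ = Π_{X̲_K} ∩ augGF⁻¹ G_v̲` normalises `Π_{X_K} ∩ augGF⁻¹ G_v̲`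
(`Π_{X_K} = Π_{X_F} ∩ augGF⁻¹ G_K`, `Π_{X_F} ⊴ Π_{C_F}`, and `augGF a` normalises `augGF(Π^±_v̲) = G_K ∩ G_v̲` — abc-iut-L5-t1's argument of
p431988 one storey up). ([IUTchI] Def 6.1 (ii) p.156) [claim: Mochizuki2012, status: disputed] -/
theorem conj_smul_PiXK_inf_eq_of_mem_normalizer_PiXund_inf {a : D.PiC}
    (ha : a ∈ Subgroup.normalizer ((D.PiXund ⊓ Gv.comap D.augGF : Subgroup D.PiC) : Set D.PiC)) :
    MulAut.conj a • (D.PiXK ⊓ Gv.comap D.augGF) = D.PiXK ⊓ Gv.comap D.augGF := by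
  have h1 : D.PiXK ⊓ Gv.comap D.augGF = D.geom.PiX ⊓ (galoisSubgroupOf F K Fbar ⊓ Gv).comap D.augGF := by
    rw [PiXK_eq_inf_comap_augGF, inf_assoc, ← Subgroup.comap_inf]
  haveI := D.geom.PiX_normal
  rw [h1, Subgroup.smul_inf, und_conj_smul_comap_eq, und_conj_smul_eq_of_map_eq D.augGF (D.map_augGF_PiXund_inf Gv) ha,
    Subgroup.Normal.conj_smul_eq_self]

/-- `N(Π^±_v̲) ≤ N(Π_{X_K} ∩ augGF⁻¹ G_v̲)`. ([IUTchI] Def 6.1 (ii) p.156) [claim: Mochizuki2012, status: disputed] -/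
theorem normalizer_PiXund_inf_le_normalizer_PiXK_inf :
    Subgroup.normalizer ((D.PiXund ⊓ Gv.comap D.augGF : Subgroup D.PiC) : Set D.PiC) ≤
      Subgroup.normalizer ((D.PiXK ⊓ Gv.comap D.augGF : Subgroup D.PiC) : Set D.PiC) := fun _ ha =>
  und_mem_normalizer_of_conj_smul_eq (D.conj_smul_PiXK_inf_eq_of_mem_normalizer_PiXund_inf Gv ha)

/-! ### The normaliser step `X̲→_v̲ ⇒ X̲_v̲` and functoriality of `†𝒟_v ↦ †𝒟_v^±` (under the local arrow law) -/

variable {Gv} [Fact l.Prime] {CG : D.geom.pe.CuspGalois} {hS : D.CuspClassesNormaliserStable}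
  (Λ : D.LocalArrowLaw CG hS (D.PiXarrow ⊓ Gv.comap D.augGF))

include Λ in
/-- **Cor 1.2 embedded, `X̲`-level**: an element normalising `Π_v̲` normalises `Π^±_v̲ = Π_{X̲_K} ∩ augGF⁻¹ G_v̲` — from the local arrow law
(`a` normalises `Π_{X̲_K}`) and `augGF a ∈ N(G_K ∩ G_v̲)`. ([IUTchI] Def 6.1 (ii) p.156) [claim: Mochizuki2012, status: disputed] -/
theorem conj_smul_PiXund_inf_eq {a : D.PiC}
    (ha : a ∈ Subgroup.normalizer ((D.PiXarrow ⊓ Gv.comap D.augGF : Subgroup D.PiC) : Set D.PiC)) :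
    MulAut.conj a • (D.PiXund ⊓ Gv.comap D.augGF) = D.PiXund ⊓ Gv.comap D.augGF := by
  have hX : MulAut.conj a • D.PiXund = D.PiXund := by
    ext x
    rw [Subgroup.mem_pointwise_smul_iff_inv_smul_mem, MulAut.smul_def, MulAut.conj_inv_apply]
    have h := (Subgroup.mem_normalizer_iff.mp (Subgroup.inv_mem _ (Λ.normalizer_le ha)) x)
    rw [inv_inv] at h
    exact h.symm
  rw [D.PiXund_inf_eq_inf_comap_inf Gv, Subgroup.smul_inf, hX, und_conj_smul_comap_eq,
    und_conj_smul_eq_of_map_eq D.augGF (D.map_augGF_PiXarrow_inf Gv) ha]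

include Λ in
/-- **`N(Π_v̲) ≤ N(Π^±_v̲)`** (every automorphism of `𝒟_v̲` extends to `†𝒟_v̲^±`, under the local arrow law).
([IUTchI] Def 6.1 (ii) p.156) [claim: Mochizuki2012, status: disputed] -/
theorem normalizer_loc_le_normalizer_pmUnd :
    Subgroup.normalizer ((D.PiXarrow ⊓ Gv.comap D.augGF : Subgroup D.PiC) : Set D.PiC) ≤
      Subgroup.normalizer ((D.PiXund ⊓ Gv.comap D.augGF : Subgroup D.PiC) : Set D.PiC) := fun _ ha =>
  und_mem_normalizer_of_conj_smul_eq (D.conj_smul_PiXund_inf_eq Λ ha)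

/-- **Functoriality of `†𝒟_v ↦ †𝒟_v^±`** (Def 6.1 (ii) «determines, in a functorial fashion»): the automorphism `xΠ_v̲ ↦ xaΠ_v̲` of the
local object extends to the automorphism `xΠ^±_v̲ ↦ xaΠ^±_v̲` of the type-`(1,l-tors)` overgroup object.
([IUTchI] Def 6.1 (ii) p.156) [claim: Mochizuki2012, status: disputed] -/
def autPMUndOfAut (a : D.PiC)
    (ha : a ∈ Subgroup.normalizer ((D.PiXarrow ⊓ Gv.comap D.augGF : Subgroup D.PiC) : Set D.PiC)) :
    D.pmUndObjModel Gv ≅ D.pmUndObjModel Gv :=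
  OrbitCat.autOfNormalizer a (D.normalizer_loc_le_normalizer_pmUnd Λ ha)

/-- **Compatibility square** `(xΠ_v̲ ↦ xaΠ_v̲) ≫ toPMUnd = toPMUnd ≫ (xΠ^± ↦ xaΠ^±)`. ([IUTchI] Def 6.1 (ii) p.156) [claim: Mochizuki2012, status: disputed] -/
theorem toPMUndModel_autPMUndOfAut (a : D.PiC)
    (ha : a ∈ Subgroup.normalizer ((D.PiXarrow ⊓ Gv.comap D.augGF : Subgroup D.PiC) : Set D.PiC)) :
    (OrbitCat.autOfNormalizer a ha).hom ≫ D.toPMUndModel Gv = D.toPMUndModel Gv ≫ (D.autPMUndOfAut Λ a ha).hom :=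
  OrbitCat.autOfNormalizer_comp_incl (D.PiXarrow_inf_le_PiXund_inf Gv) ha (D.normalizer_loc_le_normalizer_pmUnd Λ ha)

/-- Automorphisms inducing the same map of `𝒟_v̲` (`a⁻¹b ∈ Π_v̲`) induce the same map of `†𝒟_v̲^±`.
([IUTchI] Def 6.1 (ii) p.156) [claim: Mochizuki2012, status: disputed] -/
theorem autPMUndOfAut_eq_of_eq {a b : D.PiC}
    (ha : a ∈ Subgroup.normalizer ((D.PiXarrow ⊓ Gv.comap D.augGF : Subgroup D.PiC) : Set D.PiC))
    (hb : b ∈ Subgroup.normalizer ((D.PiXarrow ⊓ Gv.comap D.augGF : Subgroup D.PiC) : Set D.PiC))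
    (h : OrbitCat.autOfNormalizer a ha = OrbitCat.autOfNormalizer b hb) :
    D.autPMUndOfAut Λ a ha = D.autPMUndOfAut Λ b hb := by
  rw [OrbitCat.autOfNormalizer_eq_iff] at h
  rw [autPMUndOfAut, autPMUndOfAut, OrbitCat.autOfNormalizer_eq_iff]
  exact D.PiXarrow_inf_le_PiXund_inf Gv h

end InitialThetaData

end LocalOvergroupUnd

end Literature.IUT.HodgeTheaters
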